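import Mathlib
import Literature.Computability.AlgebraicComplexity.CommutativeExtensionSimulation
import Literature.GroupTheory.FiniteAbelian.MaximalOrderSummand
import HarnessLib

/-!
# Simulating a finitely generated commutative coefficient algebra (Hrubeš–Yehudayoff 2011, Thm 4.2,
# spanning-family form) and descent of circuit complexity to the base ring

The tree's `CommExtSim.complexity_lmap_le`
(`Literature/Computability/AlgebraicComplexity/CommutativeExtensionSimulation.lean`) simulates an
arithmetic circuit over a commutative `k`-algebra `R` that is FREE with a finite basis. This file
removes freeness: it suffices that `R` is SPANNED as a `k`-module by a finite family
`s : ι → R` (`|ι| = d`). Every gate value `v ∈ R[X]` is stored by `d` CHOSEN coordinate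
polynomials `v_c ∈ k[X]` with `v = ∑_c s_c · v_c` (representatives, no uniqueness needed): a
constant `r` is stored as a chosen representation `rep r`, a product `u · u'` as the bilinear
forms `∑_{j,l} rep (s_j s_l)_c · u_j u'_l`, a weighted sum through `rep (r s_l)_c`. The invariant
"the stored coordinates RECONSTRUCT the gate value" (`recon`) replaces "the stored coordinates ARE
the basis coordinates" of the free case; the substitution bookkeeping and the cost count are those
of the free case verbatim (re-run on the new definitions — they cannot be imported, the objects
differ; the substitution bound `complexity_aeval_le` and the list/`Finset` cost lemmas of
`CommExtSim` ARE imported by name). Hence for every `k`-linear functional `φ : R → k` and every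
`F ∈ R[X_σ]` (`σ` finite)

  `L_k(φ(F)) ≤ (5d³ + 6d² + 2d) · L_R(F) + 3d`        (`CommExtSimSpan.complexity_lmap_le_of_span`),

`φ(F)` = `φ` applied coefficientwise (`CommExtSim.lmap`).

TYPED VS PRINTED. Hrubeš–Yehudayoff 2011, Thm 4.2 (Theory of Computing 7, §4) is PRINTED for a
ring extension `R' ⊇ R` of "dimension `k`", which they DEFINE (§2) as: there are `e_1 = 1, e_2, …,
e_k ∈ R'` commuting with `R` such that every `b ∈ R'` is written UNIQUELY as `∑ b_i e_i`, `b_i ∈ R`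
— i.e. `R'` is FREE over `R` with a basis containing `1`; conclusion `C_R(f) ≤ O(k³)·C_{R'}(f)`
for `f ∈ R[X]` (read off as the `e_1`-coordinate `f = f_0`). The tree's
`CommExtSim.complexity_lmap_le` is that statement (commutative case, any basis, any functional).
The form proved HERE is OUR GENERALISATION, after and by the printed proof: uniqueness is
dropped (any finite spanning family), the gate-by-gate structure-constant simulation and the
cubic count are the printed ones, and the printed last step "`f = f_0`" becomes "read through a
`k`-linear `φ` with `φ(1) = 1`" (a retraction), which exists automatically over a field and over
`ℤ/m` (below). Nothing printed is weakened; the cite tags below name Thm 4.2 as the source of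
the ARGUMENT. [cite: HrubesYehudayoff2011, Thm 4.2 and its proof (§4)]

## Descent to the base ring

If moreover `φ(1) = 1` (a `k`-linear retraction of `algebraMap k R`), then for `F ∈ k[X]`,
`φ(F ⊗ 1) = F`, so

  `L_k(F) ≤ (5d³ + 6d² + 2d) · L_R(F) + 3d`            (`complexity_le_of_span_of_retraction`):

constants from a commutative coefficient algebra generated by `d` elements help at most
polynomially in `d` (converse of the free direction `L_R(F) ≤ L_k(F)`, tree
`complexity_map_le`). A retraction exists whenever `k = ℤ/m` and `m = 0` in `R` faithfully, i.e.
`R` has characteristic exactly `m` (`exists_linearMap_zmod_map_one`: `ℤ/m` is self-injective —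
tree `Literature.GroupTheory.FiniteAbelian.zmod_injective`, Hungerford IV §6 Ex. 7 (d) — so the
injective `ℤ/m`-linear map `ℤ/m → R` splits), giving the instance used by the `TwoAdicLadder`
route of `Summits/ValiantsHypothesis` (descent from a finite chain ring of characteristic `2^(k+1)`
generated by `d` elements to the prime ring `ℤ/2^(k+1)`, uniformly in `k`):

  `L_{ℤ/m}(F) ≤ (5d³ + 6d² + 2d) · L_R(F) + 3d`
  (`complexity_zmod_le_of_span`, `complexity_zmod_le_of_addSubgroup_closure`).

## Contents

* plumbing (private): `recon s v = ∑_c C (s c) * (v c ⊗ 1)` and its calculus, the list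
  bookkeeping of the substitutions, the reconstruction invariant `recon_coordValues`, the
  per-gate cost counts;
* the simulation data `opndPoly`, `prodPoly`, `gatePoly`, `substGate`, `substGates`, `readC`,
  `coordValues`, `outPoly`, `simPoly` (same shape as the free case, `rep` for `Basis.repr`);
* `simPoly_eq` (correctness), `complexity_simPoly_le` (cost), `complexity_lmap_le_of_rep`,
  `complexity_lmap_le_of_span` (the theorem), `complexity_le_of_span_of_retraction`,
  `exists_linearMap_zmod_map_one`, `complexity_zmod_le_of_span`,
  `complexity_zmod_le_of_addSubgroup_closure` (descent).

## Sources

* [HrubesYehudayoff2011] P. Hrubeš, A. Yehudayoff, *Arithmetic complexity in ring extensions*,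
  Theory of Computing 7 (2011) 119–129, Thm 4.2 and its proof (§4: structure constants of a
  generating family).
* [Burgisser2000] P. Bürgisser, *Completeness and Reduction in Algebraic Complexity Theory*,
  Springer 2000, Def. 2.1 (the measure `L`), Rem. 2.7 (substitution), §4.1 (extension of scalars).
* [Hungerford1974] T. W. Hungerford, *Algebra*, GTM 73, Ch. IV §6 Exercise 7 (d) (`ℤ/m` is
  self-injective).

## Design choices / not here

* THEOREMS AND SIMULATION DATA ONLY: no named fact, no instance; net debt 0.
* The spanning family is explicit data `s : ι → R` with `Submodule.span k (range s) = ⊤`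
  (or, over `ℤ/m`, `AddSubgroup.closure (range s) = ⊤`); representatives `rep` are chosen by
  `Submodule.mem_span_range_iff_exists_fun`.
* Not here: the noncommutative case of Thm 4.2, formula size, and any claim about coefficient
  algebras with a number of generators super-polynomial in the relevant parameter (that is the
  open content of `stub_descent` of the `PrecisionLadder` line; nothing in this file bears on it).
-/

noncomputable section

open MvPolynomial

namespace Literature.Computability.AlgebraicComplexity

universe u v w x

namespace CommExtSimSpan

variable {k : Type u} [CommRing k] {R : Type v} [CommRing R]
variable {σ : Type w} {ι : Type x}

/-! ### Reconstruction from coordinate polynomials -/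

section Recon

variable [Algebra k R] [Fintype ι] (s : ι → R)

/-- `recon s v = ∑_c C (s c) * (v c ⊗_k R)`: the `R`-polynomial whose (chosen) coordinate
polynomials along the family `s` are `v`. [folklore] -/
def recon {τ : Type*} (v : ι → MvPolynomial τ k) : MvPolynomial τ R :=
  ∑ c, C (s c) * MvPolynomial.map (algebraMap k R) (v c)

variable {τ : Type*}

/-- `recon` of the zero coordinates. [folklore] -/
@[simp] private theorem recon_zero : recon s (0 : ι → MvPolynomial τ k) = 0 := by
  simp [recon]

/-- `recon` is additive. [folklore] -/
private theorem recon_add (v v' : ι → MvPolynomial τ k) :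
    recon s (v + v') = recon s v + recon s v' := by
  simp only [recon, Pi.add_apply, map_add, mul_add, Finset.sum_add_distrib]

/-- `recon` is additive (pointwise-lambda form). [folklore] -/
private theorem recon_add' (v v' : ι → MvPolynomial τ k) :
    recon s (fun c => v c + v' c) = recon s v + recon s v' :=
  recon_add s v v'

/-- `recon` commutes with finite sums. [folklore] -/
private theorem recon_finset_sum {α : Type*} (t : Finset α) (v : α → ι → MvPolynomial τ k) :
    recon s (fun c => ∑ a ∈ t, v a c) = ∑ a ∈ t, recon s (v a) := by
  simp only [recon, map_sum, Finset.mul_sum]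
  exact Finset.sum_comm

/-- `recon` of a coordinate vector of the form `c ↦ a c • G` (`G` fixed):
`(∑_c a_c • s_c) · G`. [folklore] -/
private theorem recon_smul_const (a : ι → k) (G : MvPolynomial τ k) :
    recon s (fun c => a c • G) = C (∑ c, a c • s c) * MvPolynomial.map (algebraMap k R) G := by
  simp only [recon, smul_eq_C_mul, map_mul, map_C, map_sum, Finset.sum_mul]
  refine Finset.sum_congr rfl fun c _ => ?_
  rw [← mul_assoc, ← map_mul, Algebra.smul_def, mul_comm (algebraMap k R (a c))]

/-- `recon` of constant coordinates `c ↦ C (a c)`: the constant `∑_c a_c • s_c`. [folklore] -/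
private theorem recon_C (a : ι → k) :
    recon s (fun c => (C (a c) : MvPolynomial τ k)) = C (∑ c, a c • s c) := by
  have h : (fun c => (C (a c) : MvPolynomial τ k)) = fun c => a c • (1 : MvPolynomial τ k) := by
    funext c; rw [smul_eq_C_mul, mul_one]
  rw [h, recon_smul_const, map_one, mul_one]

variable (rep : R → ι → k)

/-- **Products through structure constants**: if `rep` represents every element along `s`
(`∑_c rep r c • s c = r`), then the bilinear coordinate vector
`c ↦ ∑_{j,l} rep (s j * s l) c • (x j * y l)` reconstructs to `recon x * recon y`. [folklore] -/
private theorem recon_bil (hrep : ∀ r : R, ∑ c, rep r c • s c = r) (x y : ι → MvPolynomial τ k) :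
    recon s (fun c => ∑ j, ∑ l, rep (s j * s l) c • (x j * y l)) = recon s x * recon s y := by
  rw [recon_finset_sum]
  conv_rhs => rw [recon, recon, Finset.sum_mul_sum]
  refine Finset.sum_congr rfl fun j _ => ?_
  rw [recon_finset_sum]
  refine Finset.sum_congr rfl fun l _ => ?_
  rw [recon_smul_const, hrep, map_mul, map_mul]
  ring

/-- **Scalars through structure constants**: `c ↦ ∑_l rep (r * s l) c • x l` reconstructs to
`C r * recon x`. [folklore] -/
private theorem recon_lin (hrep : ∀ r : R, ∑ c, rep r c • s c = r) (r : R)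
    (x : ι → MvPolynomial τ k) :
    recon s (fun c => ∑ l, rep (r * s l) c • x l) = C r * recon s x := by
  rw [recon_finset_sum]
  conv_rhs => rw [recon, Finset.mul_sum]
  refine Finset.sum_congr rfl fun l _ => ?_
  rw [recon_smul_const, hrep, map_mul, mul_assoc]

end Recon

/-! ### The simulating substitutions

As in the free case we fix a circuit bound `N` and work in `k[X_σ, y_{j,c}]`
(`σ ⊕ (Fin N × ι)`), with the fresh variable `y_{j,c} = CommExtSim.yv N j c` standing for the
chosen coordinate `c` of the value of gate `j`. -/

section Circuit

open ArithCircuit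

variable (s : ι → R) (rep : R → ι → k) (N : ℕ)

/-- Coordinate `c` of an operand of gate number `t`: `X x = 1 • X x` is stored as
`(rep 1 c) • X x`, a constant `r` as `rep r c`, a reference to gate `j < t` reads `y_{j,c}`
(junk references `t ≤ j` are `0`). [folklore] -/
def opndPoly (t : ℕ) : Operand R σ → ι → MvPolynomial (σ ⊕ (Fin N × ι)) k
  | .var x, c => (rep 1 c) • X (Sum.inl x)
  | .const r, c => C (rep r c)
  | .gate j, c => if j < t then CommExtSim.yv N j c else 0

variable [Fintype ι]

/-- Coordinate `c` of the product of a list of operands of gate `t` (bilinear expansion through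
the chosen structure constants `rep (s j * s l)`, one factor at a time). [folklore] -/
def prodPoly (t : ℕ) : List (Operand R σ) → ι → MvPolynomial (σ ⊕ (Fin N × ι)) k
  | [], c => C (rep 1 c)
  | [u], c => opndPoly rep N t u c
  | u :: v :: us, c =>
      ∑ j, ∑ l, (rep (s j * s l) c) • (opndPoly rep N t u j * prodPoly t (v :: us) l)

/-- Coordinate `c` of the value of gate `g` placed at position `t`. [folklore] -/
def gatePoly (t : ℕ) : Gate R σ → ι → MvPolynomial (σ ⊕ (Fin N × ι)) k
  | .sum args, c => (args.map fun a => ∑ l, (rep (a.1 * s l) c) • opndPoly rep N t a.2 l).sum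
  | .prod args, c => prodPoly s rep N t args c

/-- The substitution eliminating the fresh variables of gate `t`:
`y_{t,c} ↦ gatePoly t g c`, all other variables fixed. [folklore] -/
def substGate (t : ℕ) (g : Gate R σ) :
    MvPolynomial (σ ⊕ (Fin N × ι)) k →ₐ[k] MvPolynomial (σ ⊕ (Fin N × ι)) k :=
  aeval (Sum.elim (fun x => X (Sum.inl x))
    fun p : Fin N × ι => if (p.1 : ℕ) = t then gatePoly s rep N t g p.2 else X (Sum.inr p))

/-- The composite substitution for a list of gates starting at position `t`
(the LAST gate is substituted first). [folklore] -/
def substGates : ℕ → List (Gate R σ) →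
    (MvPolynomial (σ ⊕ (Fin N × ι)) k →ₐ[k] MvPolynomial (σ ⊕ (Fin N × ι)) k)
  | _, [] => AlgHom.id k _
  | t, g :: gs => (substGate s rep N t g).comp (substGates (t + 1) gs)

/-- Reading the fresh variables against a list `cv` of coordinate vectors over `k`:
`y_{j,c} ↦ (cv[j]) c` (`0` out of range), `X x ↦ X x`. [folklore] -/
def readC (cv : List (ι → MvPolynomial σ k)) :
    MvPolynomial (σ ⊕ (Fin N × ι)) k →ₐ[k] MvPolynomial σ k :=
  aeval (Sum.elim X fun p : Fin N × ι => (cv.getD (p.1 : ℕ) 0) p.2)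

/-- The chosen coordinate vectors of the gates, computed by the same left fold as
`ArithCircuit.gateValues`: the vector of gate `t` is `c ↦ gatePoly t g c` read against the
vectors of the earlier gates. [folklore] -/
def coordValues (gs : List (Gate R σ)) : List (ι → MvPolynomial σ k) :=
  gs.foldl (fun cv g => cv ++ [fun c => readC N cv (gatePoly s rep N cv.length g c)]) []

/-! #### Semantics -/

omit [Fintype ι] in
/-- `readC` fixes the original variables. [folklore] -/
@[simp] private theorem readC_X_inl (cv : List (ι → MvPolynomial σ k)) (x : σ) :
    readC N cv (X (Sum.inl x)) = X x := by
  simp [readC]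

omit [Fintype ι] in
/-- `readC` reads entry `c` of `cv[j]` at `y_{j,c}`. [folklore] -/
@[simp] private theorem readC_X_inr (cv : List (ι → MvPolynomial σ k)) (p : Fin N × ι) :
    readC N cv (X (Sum.inr p)) = (cv.getD (p.1 : ℕ) 0) p.2 := by
  simp [readC]

/-- One step of the fold defining `coordValues`. [folklore] -/
@[simp] private theorem coordValues_append_singleton (gs : List (Gate R σ)) (g : Gate R σ) :
    coordValues s rep N (gs ++ [g]) = coordValues s rep N gs ++
      [fun c => readC N (coordValues s rep N gs)
        (gatePoly s rep N (coordValues s rep N gs).length g c)] := by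
  simp [coordValues, List.foldl_append]

/-- `coordValues` has one entry per gate. [folklore] -/
@[simp] private theorem coordValues_length (gs : List (Gate R σ)) :
    (coordValues s rep N gs).length = gs.length := by
  induction gs using List.reverseRecOn with
  | nil => rfl
  | append_singleton gs g ih => simp [coordValues_append_singleton, ih]

/-- Unfolding `substGates` on a snoc. [folklore] -/
private theorem substGates_append_singleton (t : ℕ) (gs : List (Gate R σ)) (g : Gate R σ) :
    substGates s rep N t (gs ++ [g]) =
      (substGates s rep N t gs).comp (substGate s rep N (t + gs.length) g) := by
  induction gs generalizing t with
  | nil => simp [substGates]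
  | cons g' gs ih =>
    simp only [List.cons_append, substGates, List.length_cons]
    rw [ih, AlgHom.comp_assoc]
    congr 2
    ring_nf

/-- One step: reading after substituting gate `t = cv.length` is reading against the extended
list of coordinate vectors. [folklore] -/
private theorem readC_comp_substGate (cv : List (ι → MvPolynomial σ k)) (g : Gate R σ) :
    (readC N cv).comp (substGate s rep N cv.length g) =
      readC N (cv ++ [fun c => readC N cv (gatePoly s rep N cv.length g c)]) := by
  refine MvPolynomial.algHom_ext fun v => ?_
  rcases v with x | ⟨j, c⟩
  · simp [substGate]
  · simp only [AlgHom.comp_apply, substGate, aeval_X, Sum.elim_inr, readC_X_inr]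
    split_ifs with hj
    · rw [hj, List.getD_append_right _ _ _ _ le_rfl, Nat.sub_self]
      simp
    · rw [readC_X_inr]
      rcases lt_or_gt_of_ne hj with hlt | hgt
      · rw [List.getD_append _ _ _ _ hlt]
      · rw [List.getD_eq_default _ _ hgt.le, List.getD_eq_default _ _
          (by simp only [List.length_append, List.length_singleton]; omega)]

/-- **Substitution semantics**: substituting all gates and then killing the fresh variables is
reading against the list of chosen coordinate vectors. [folklore] -/
private theorem readC_nil_comp_substGates (gs : List (Gate R σ)) :
    (readC N []).comp (substGates s rep N 0 gs) = readC N (coordValues s rep N gs) := by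
  induction gs using List.reverseRecOn with
  | nil => simp [substGates, coordValues]
  | append_singleton gs g ih =>
    rw [substGates_append_singleton, ← AlgHom.comp_assoc, ih, zero_add,
      coordValues_append_singleton, ← coordValues_length (k := k) s rep N gs,
      readC_comp_substGate s rep N (coordValues s rep N gs) g]

end Circuit

/-! #### Reconstruction: the chosen coordinates compute the gate values -/

section Reconstruction

open ArithCircuit

variable [Algebra k R] (s : ι → R) (rep : R → ι → k) (N : ℕ) [Fintype ι]

/-- An operand polynomial, read against coordinate vectors reconstructing `vals`, reconstructs
the operand's value. [folklore] -/
private theorem recon_readC_opndPoly (hrep : ∀ r : R, ∑ c, rep r c • s c = r)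
    (vals : List (MvPolynomial σ R)) (cv : List (ι → MvPolynomial σ k))
    (hlen : cv.length = vals.length) (hN : cv.length ≤ N)
    (hcv : ∀ j, recon s (cv.getD j 0) = vals.getD j 0) (u : Operand R σ) :
    recon s (fun c => readC N cv (opndPoly rep N cv.length u c)) = u.eval vals := by
  cases u with
  | var x =>
    simp only [opndPoly, map_smul, readC_X_inl, Operand.eval]
    rw [recon_smul_const, hrep, map_X, C_1, one_mul]
  | const r =>
    simp only [opndPoly, Operand.eval]
    have h : (fun c => readC N cv (C (rep r c))) = fun c => (C (rep r c) : MvPolynomial σ k) := by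
      funext c; exact aeval_C _ _
    rw [h, recon_C, hrep]
  | gate j =>
    by_cases hj : j < cv.length
    · have h : (fun c => readC N cv (opndPoly rep N cv.length (.gate j) c)) = cv.getD j 0 := by
        funext c; simp [opndPoly, hj, CommExtSim.yv, hj.trans_le hN]
      rw [h, hcv, Operand.eval_gate]
    · have h : (fun c => readC N cv (opndPoly rep N cv.length (.gate j) c)) =
          (0 : ι → MvPolynomial σ k) := by
        funext c; simp [opndPoly, hj]
      rw [h, recon_zero, Operand.eval_gate,
        List.getD_eq_default _ _ (by rw [← hlen]; exact not_lt.mp hj)]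

/-- A product polynomial, read against reconstructing coordinate vectors, reconstructs the
product. [folklore] -/
private theorem recon_readC_prodPoly (hrep : ∀ r : R, ∑ c, rep r c • s c = r)
    (vals : List (MvPolynomial σ R)) (cv : List (ι → MvPolynomial σ k))
    (hlen : cv.length = vals.length) (hN : cv.length ≤ N)
    (hcv : ∀ j, recon s (cv.getD j 0) = vals.getD j 0) (us : List (Operand R σ)) :
    recon s (fun c => readC N cv (prodPoly s rep N cv.length us c)) =
      (us.map fun u => u.eval vals).prod := by
  induction us with
  | nil =>
    simp only [prodPoly, List.map_nil, List.prod_nil]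
    have h : (fun c => readC N cv (C (rep 1 c))) = fun c => (C (rep 1 c) : MvPolynomial σ k) := by
      funext c; exact aeval_C _ _
    rw [h, recon_C, hrep, C_1]
  | cons u us ih =>
    cases us with
    | nil =>
      simp only [prodPoly, List.map_cons, List.map_nil, List.prod_cons, List.prod_nil, mul_one]
      exact recon_readC_opndPoly s rep N hrep vals cv hlen hN hcv u
    | cons v us =>
      rw [List.map_cons, List.prod_cons]
      simp only [prodPoly, map_sum, map_smul, map_mul]
      rw [recon_bil s rep hrep, recon_readC_opndPoly s rep N hrep vals cv hlen hN hcv u, ih]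

/-- The weighted-sum polynomials of a list of (coefficient, operand) pairs reconstruct the
weighted sum. [folklore] -/
private theorem recon_readC_sumArgs (hrep : ∀ r : R, ∑ c, rep r c • s c = r)
    (vals : List (MvPolynomial σ R)) (cv : List (ι → MvPolynomial σ k))
    (hlen : cv.length = vals.length) (hN : cv.length ≤ N)
    (hcv : ∀ j, recon s (cv.getD j 0) = vals.getD j 0) (args : List (R × Operand R σ)) :
    recon s (fun c => readC N cv
        ((args.map fun a => ∑ l, (rep (a.1 * s l) c) • opndPoly rep N cv.length a.2 l).sum)) =
      (args.map fun a => a.1 • a.2.eval vals).sum := by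
  induction args with
  | nil =>
    simp only [List.map_nil, List.sum_nil, map_zero]
    exact recon_zero s
  | cons a args ih =>
    simp only [List.map_cons, List.sum_cons, map_add]
    rw [recon_add', ih]
    congr 1
    simp only [map_sum, map_smul]
    rw [recon_lin s rep hrep, recon_readC_opndPoly s rep N hrep vals cv hlen hN hcv a.2,
      smul_eq_C_mul]

/-- A gate polynomial, read against reconstructing coordinate vectors, reconstructs the gate's
value. [folklore] -/
private theorem recon_readC_gatePoly (hrep : ∀ r : R, ∑ c, rep r c • s c = r)
    (vals : List (MvPolynomial σ R)) (cv : List (ι → MvPolynomial σ k))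
    (hlen : cv.length = vals.length) (hN : cv.length ≤ N)
    (hcv : ∀ j, recon s (cv.getD j 0) = vals.getD j 0) (g : Gate R σ) :
    recon s (fun c => readC N cv (gatePoly s rep N cv.length g c)) = g.eval vals := by
  cases g with
  | sum args =>
    simp only [gatePoly, Gate.eval]
    exact recon_readC_sumArgs s rep N hrep vals cv hlen hN hcv args
  | prod args =>
    simp only [gatePoly, Gate.eval]
    exact recon_readC_prodPoly s rep N hrep vals cv hlen hN hcv args

/-- **The chosen coordinates reconstruct the gate values**: entry `j` of `coordValues gs`
reconstructs entry `j` of `gateValues gs` (both `0` out of range). [folklore] -/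
private theorem recon_coordValues (hrep : ∀ r : R, ∑ c, rep r c • s c = r) (gs : List (Gate R σ))
    (hN : gs.length ≤ N) (j : ℕ) :
    recon s ((coordValues s rep N gs).getD j 0) = (gateValues gs).getD j 0 := by
  induction gs using List.reverseRecOn generalizing j with
  | nil => simp [coordValues, gateValues]
  | append_singleton gs g ih =>
    rw [List.length_append, List.length_singleton] at hN
    have ih' := ih (by omega)
    rw [coordValues_append_singleton, gateValues_append_singleton]
    have hcl := coordValues_length s rep N gs
    have hgl := gateValues_length (k := R) gs
    rcases lt_trichotomy j gs.length with hj | hj | hj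
    · rw [List.getD_append _ _ _ _ (hcl.symm ▸ hj), List.getD_append _ _ _ _ (hgl.symm ▸ hj), ih']
    · subst hj
      rw [List.getD_append_right _ _ _ _ hcl.le, List.getD_append_right _ _ _ _ hgl.le,
        Nat.sub_eq_zero_of_le hcl.ge, Nat.sub_eq_zero_of_le hgl.ge]
      simp only [List.getD_eq_getElem?_getD, List.getElem?_cons_zero, Option.getD_some]
      exact recon_readC_gatePoly s rep N hrep (gateValues gs) (coordValues s rep N gs)
        (hcl.trans hgl.symm) (by rw [hcl]; omega) ih' g
    · rw [List.getD_eq_default _ _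
          (by simp only [List.length_append, List.length_singleton, hcl]; omega),
        List.getD_eq_default _ _
          (by simp only [List.length_append, List.length_singleton, hgl]; omega),
        recon_zero]

end Reconstruction

/-! #### Cost (verbatim from the free case, `rep` for `Basis.repr`) -/

section Cost

open ArithCircuit

variable (s : ι → R) (rep : R → ι → k) (N : ℕ)

/-- An operand coordinate costs at most one gate. [folklore] -/
private theorem complexity_opndPoly_le (t : ℕ) (u : Operand R σ) (c : ι) :
    complexity (opndPoly (σ := σ) rep N t u c) ≤ 1 := by
  cases u with
  | var x =>
    refine (complexity_smul_le_holds _ _).trans ?_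
    rw [CommExtSim.complexity_X_eq]
  | const r =>
    rw [opndPoly, CommExtSim.complexity_C_eq]
    exact Nat.zero_le _
  | gate j =>
    simp only [opndPoly]
    split_ifs
    · rw [CommExtSim.complexity_yv]; exact Nat.zero_le _
    · rw [CommExtSim.complexity_zero']; exact Nat.zero_le _

variable [Fintype ι]

/-- A structure-constant combination `∑ l, a l • opndPoly … l` costs at most `3 |ι|`.
[folklore] -/
private theorem complexity_sum_smul_opndPoly_le (t : ℕ) (u : Operand R σ) (a : ι → k) :
    complexity (∑ l, a l • opndPoly (σ := σ) rep N t u l) ≤ 3 * Fintype.card ι := by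
  calc complexity (∑ l, a l • opndPoly (σ := σ) rep N t u l)
      ≤ ∑ l, complexity (a l • opndPoly (σ := σ) rep N t u l) + (Finset.univ : Finset ι).card :=
        complexity_finset_sum_le _ _
    _ ≤ ∑ _l : ι, 2 + (Finset.univ : Finset ι).card := by
        gcongr with l
        exact (complexity_smul_le_holds _ _).trans
          (Nat.add_le_add_right (complexity_opndPoly_le rep N t u l) 1)
    _ = 3 * Fintype.card ι := by simp [Finset.card_univ]; ring

/-- A product coordinate of fan-in `≤ 2` costs at most `5 |ι|² + |ι|`. [folklore] -/
private theorem complexity_prodPoly_le (t : ℕ) (us : List (Operand R σ)) (hus : us.length ≤ 2)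
    (c : ι) :
    complexity (prodPoly s rep N t us c) ≤ 5 * Fintype.card ι ^ 2 + Fintype.card ι := by
  match us, hus with
  | [], _ =>
    rw [prodPoly, CommExtSim.complexity_C_eq]
    exact Nat.zero_le _
  | [u], _ =>
    rw [prodPoly]
    refine (complexity_opndPoly_le rep N t u c).trans ?_
    have : 1 ≤ Fintype.card ι := Fintype.card_pos_iff.2 ⟨c⟩
    nlinarith
  | [u, v], _ =>
    rw [prodPoly]
    calc complexity (∑ j, ∑ l, (rep (s j * s l) c) •
            (opndPoly rep N t u j * prodPoly s rep N t [v] l))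
        ≤ ∑ j, complexity (∑ l, (rep (s j * s l) c) •
            (opndPoly rep N t u j * prodPoly s rep N t [v] l)) + (Finset.univ : Finset ι).card :=
          complexity_finset_sum_le _ _
      _ ≤ ∑ _j : ι, (5 * Fintype.card ι) + (Finset.univ : Finset ι).card := by
          gcongr with j
          calc complexity (∑ l, (rep (s j * s l) c) •
                  (opndPoly rep N t u j * prodPoly s rep N t [v] l))
              ≤ ∑ l, complexity ((rep (s j * s l) c) •
                  (opndPoly rep N t u j * prodPoly s rep N t [v] l)) +
                  (Finset.univ : Finset ι).card :=
                complexity_finset_sum_le _ _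
            _ ≤ ∑ _l : ι, 4 + (Finset.univ : Finset ι).card := by
                gcongr with l
                refine (complexity_smul_le_holds _ _).trans ?_
                refine Nat.add_le_add_right ((complexity_mul_le_holds _ _).trans ?_) 1
                have h1 := complexity_opndPoly_le (σ := σ) rep N t u j
                have h2 : complexity (prodPoly s rep N t [v] l) ≤ 1 := by
                  rw [prodPoly]; exact complexity_opndPoly_le rep N t v l
                omega
            _ = 5 * Fintype.card ι := by simp [Finset.card_univ]; ring
      _ = 5 * Fintype.card ι ^ 2 + Fintype.card ι := by simp [Finset.card_univ]; ring
  | _ :: _ :: _ :: _, h => simp at h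

/-- **Cost of one gate**: all `|ι|` coordinates of a fan-in-two gate together cost at most
`5|ι|³ + 6|ι|² + 2|ι|` gates over `k`. [folklore] -/
private theorem sum_complexity_gatePoly_le (t : ℕ) (g : Gate R σ) (hg : g.fanIn ≤ 2) :
    ∑ c, complexity (gatePoly s rep N t g c) ≤
      5 * Fintype.card ι ^ 3 + 6 * Fintype.card ι ^ 2 + 2 * Fintype.card ι := by
  cases g with
  | sum args =>
    have hlen : args.length ≤ 2 := by simpa [Gate.fanIn, Gate.args] using hg
    calc ∑ c, complexity (gatePoly s rep N t (.sum args) c)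
        ≤ ∑ _c : ι, (6 * Fintype.card ι + 2) := by
          gcongr with c
          rw [gatePoly]
          refine (CommExtSim.complexity_list_sum_le _).trans ?_
          rw [List.map_map, List.length_map]
          have hsum : (args.map (complexity ∘ fun a =>
              ∑ l, (rep (a.1 * s l) c) • opndPoly (σ := σ) rep N t a.2 l)).sum ≤
              args.length * (3 * Fintype.card ι) := by
            have := List.sum_le_card_nsmul (args.map (complexity ∘ fun a =>
              ∑ l, (rep (a.1 * s l) c) • opndPoly (σ := σ) rep N t a.2 l)) (3 * Fintype.card ι)
              (fun x hx => by
                simp only [List.mem_map, Function.comp_apply] at hx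
                obtain ⟨a, _, rfl⟩ := hx
                exact complexity_sum_smul_opndPoly_le rep N t a.2 _)
            simpa using this
          calc _ ≤ args.length * (3 * Fintype.card ι) + args.length := Nat.add_le_add_right hsum _
            _ ≤ 2 * (3 * Fintype.card ι) + 2 := by gcongr
            _ = 6 * Fintype.card ι + 2 := by ring
      _ = 6 * Fintype.card ι ^ 2 + 2 * Fintype.card ι := by simp [Finset.card_univ]; ring
      _ ≤ _ := by omega
  | prod args =>
    have hlen : args.length ≤ 2 := by simpa [Gate.fanIn, Gate.args] using hg
    calc ∑ c, complexity (gatePoly s rep N t (.prod args) c)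
        ≤ ∑ _c : ι, (5 * Fintype.card ι ^ 2 + Fintype.card ι) := by
          gcongr with c
          rw [gatePoly]
          exact complexity_prodPoly_le s rep N t args hlen c
      _ = 5 * Fintype.card ι ^ 3 + Fintype.card ι ^ 2 := by simp [Finset.card_univ]; ring
      _ ≤ _ := by nlinarith

variable [Fintype σ]

/-- **Cost of one substitution step** (Bürgisser's substitution bound): eliminating the fresh
variables of gate `t` costs at most the cost of its `|ι|` coordinate polynomials. [folklore] -/
private theorem complexity_substGate_le (t : ℕ) (g : Gate R σ)
    (H : MvPolynomial (σ ⊕ (Fin N × ι)) k) :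
    complexity (substGate s rep N t g H) ≤
      complexity H + ∑ c, complexity (gatePoly s rep N t g c) := by
  rw [substGate]
  refine (complexity_aeval_le _ _).trans (Nat.add_le_add_left ?_ _)
  rw [Fintype.sum_sum_type, Fintype.sum_prod_type]
  simp only [Sum.elim_inl, Sum.elim_inr, CommExtSim.complexity_X_eq, Finset.sum_const_zero,
    zero_add, apply_ite complexity]
  rw [Finset.sum_comm]
  gcongr with c
  exact CommExtSim.sum_fin_ite_val_eq_le N t _

/-- **Cost of the whole simulation**: `|gs| · (5|ι|³ + 6|ι|² + 2|ι|)` on top of the cost of the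
polynomial being substituted into. [folklore] -/
private theorem complexity_substGates_le (gs : List (Gate R σ)) (hfan : ∀ g ∈ gs, g.fanIn ≤ 2)
    (t : ℕ)
    (H : MvPolynomial (σ ⊕ (Fin N × ι)) k) :
    complexity (substGates s rep N t gs H) ≤ complexity H +
      gs.length * (5 * Fintype.card ι ^ 3 + 6 * Fintype.card ι ^ 2 + 2 * Fintype.card ι) := by
  induction gs generalizing t with
  | nil => simp [substGates]
  | cons g gs ih =>
    rw [substGates, AlgHom.comp_apply, List.length_cons]
    have hg : g.fanIn ≤ 2 := hfan g (by simp)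
    have ih' := ih (fun g' hg' => hfan g' (by simp [hg'])) (t + 1)
    calc complexity (substGate s rep N t g (substGates s rep N (t + 1) gs H))
        ≤ complexity (substGates s rep N (t + 1) gs H) +
            ∑ c, complexity (gatePoly s rep N t g c) :=
          complexity_substGate_le s rep N t g _
      _ ≤ (complexity H + gs.length *
            (5 * Fintype.card ι ^ 3 + 6 * Fintype.card ι ^ 2 + 2 * Fintype.card ι)) +
            (5 * Fintype.card ι ^ 3 + 6 * Fintype.card ι ^ 2 + 2 * Fintype.card ι) :=
          Nat.add_le_add ih' (sum_complexity_gatePoly_le s rep N t g hg)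
      _ = _ := by ring

/-- Killing the fresh variables is free. [folklore] -/
private theorem complexity_readC_nil_le (H : MvPolynomial (σ ⊕ (Fin N × ι)) k) :
    complexity (readC N ([] : List (ι → MvPolynomial σ k)) H) ≤ complexity H := by
  rw [readC]
  refine (complexity_aeval_le _ _).trans (le_of_eq ?_)
  rw [Fintype.sum_sum_type]
  simp

end Cost

/-! ### The simulation theorem -/

section Main

open ArithCircuit

variable [Algebra k R] [Fintype ι] (s : ι → R) (rep : R → ι → k) [Fintype σ]

/-- The output polynomial: `φ` of the output operand, in chosen coordinates. [folklore] -/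
def outPoly (P : ArithCircuit R σ) (φ : R →ₗ[k] k) : MvPolynomial (σ ⊕ (Fin P.size × ι)) k :=
  ∑ c, φ (s c) • opndPoly rep P.size P.size P.output c

/-- The simulating polynomial of a circuit `P` over `R`, read through `φ`. [folklore] -/
def simPoly (P : ArithCircuit R σ) (φ : R →ₗ[k] k) : MvPolynomial σ k :=
  readC P.size [] (substGates s rep P.size 0 P.gates (outPoly s rep P φ))

omit [Fintype σ] in
/-- `φ` applied coefficientwise to a reconstruction: `φ(∑_c s_c · v_c) = ∑_c φ(s_c) • v_c`.
[folklore] -/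
private theorem lmap_recon (φ : R →ₗ[k] k) (v : ι → MvPolynomial σ k) :
    CommExtSim.lmap φ (recon s v) = ∑ c, φ (s c) • v c := by
  rw [recon, CommExtSim.lmap_sum]
  refine Finset.sum_congr rfl fun c _ => ?_
  rw [CommExtSim.lmap_C_mul_map]

omit [Fintype σ] in
/-- **Correctness of the simulation** (the invariant of Hrubeš–Yehudayoff's proof: the stored
coordinates reconstruct the gate values): if `rep` represents along `s`, the simulating
polynomial is `φ` applied coefficientwise to the polynomial computed by `P`.
[cite: HrubesYehudayoff2011, Thm 4.2 (proof)] -/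
theorem simPoly_eq (hrep : ∀ r : R, ∑ c, rep r c • s c = r) (P : ArithCircuit R σ)
    (φ : R →ₗ[k] k) : simPoly s rep P φ = CommExtSim.lmap φ P.eval := by
  rw [simPoly, ← AlgHom.comp_apply, readC_nil_comp_substGates s rep P.size P.gates,
    outPoly, map_sum]
  have hcl : (coordValues s rep P.size P.gates).length = P.size := coordValues_length s rep _ _
  have hgl : (gateValues P.gates).length = P.size := gateValues_length P.gates
  have hrec := recon_readC_opndPoly s rep P.size hrep (gateValues P.gates)
    (coordValues s rep P.size P.gates) (hcl.trans hgl.symm) hcl.le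
    (recon_coordValues s rep P.size hrep P.gates le_rfl) P.output
  rw [hcl] at hrec
  rw [ArithCircuit.eval, ← hrec, lmap_recon]
  refine Finset.sum_congr rfl fun c _ => ?_
  rw [map_smul]

/-- **Cost of the simulation** (the count of Hrubeš–Yehudayoff's proof, cubic in the number of
generators): `L_k(simPoly) ≤ 3|ι| + |P| · (5|ι|³ + 6|ι|² + 2|ι|)` for fan-in-two `P`.
[cite: HrubesYehudayoff2011, Thm 4.2 (proof)] -/
theorem complexity_simPoly_le (P : ArithCircuit R σ) (hP : P.IsFanInTwo) (φ : R →ₗ[k] k) :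
    complexity (simPoly s rep P φ) ≤ 3 * Fintype.card ι +
      P.size * (5 * Fintype.card ι ^ 3 + 6 * Fintype.card ι ^ 2 + 2 * Fintype.card ι) := by
  rw [simPoly]
  refine (complexity_readC_nil_le P.size _).trans ?_
  refine (complexity_substGates_le s rep P.size P.gates hP 0 _).trans ?_
  refine Nat.add_le_add_right ?_ _
  rw [outPoly]
  calc complexity (∑ c, φ (s c) • opndPoly rep P.size P.size P.output c)
      ≤ ∑ c, complexity (φ (s c) • opndPoly rep P.size P.size P.output c) +
          (Finset.univ : Finset ι).card := complexity_finset_sum_le _ _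
    _ ≤ ∑ _c : ι, 2 + (Finset.univ : Finset ι).card := by
        gcongr with c
        exact (complexity_smul_le_holds _ _).trans
          (Nat.add_le_add_right (complexity_opndPoly_le rep _ _ _ c) 1)
    _ = 3 * Fintype.card ι := by simp [Finset.card_univ]; ring

/-- **Simulation with explicit representatives** (our spanning-family form of the printed
free-basis statement; same proof): if `rep r` represents every `r ∈ R` along `s`
(`∑_c rep r c • s c = r`), then `L_k(φ(F)) ≤ (5|ι|³ + 6|ι|² + 2|ι|) · L_R(F) + 3|ι|`.
[cite: HrubesYehudayoff2011, Thm 4.2 and its proof (§4)] -/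
theorem complexity_lmap_le_of_rep (hrep : ∀ r : R, ∑ c, rep r c • s c = r)
    (φ : R →ₗ[k] k) (F : MvPolynomial σ R) :
    complexity (CommExtSim.lmap φ F) ≤
      (5 * Fintype.card ι ^ 3 + 6 * Fintype.card ι ^ 2 + 2 * Fintype.card ι) * complexity F +
        3 * Fintype.card ι := by
  obtain ⟨P, hP1, hP2, hP3⟩ := exists_computes_size_eq_complexity F
  rw [Computes] at hP2
  have h1 := complexity_simPoly_le s rep P hP1 φ
  rw [simPoly_eq s rep hrep, hP2, hP3] at h1
  refine h1.trans (le_of_eq ?_)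
  ring

end Main

section Span

variable [Algebra k R] [Fintype ι] [Fintype σ]

/-- **Simulating a finitely generated commutative coefficient algebra** (OUR spanning-family
generalisation of Hrubeš–Yehudayoff 2011, Thm 4.2, commutative case — printed for `R` free over
`k` with a basis containing `1`; same proof): if the commutative `k`-algebra `R` is spanned as a
`k`-module by a finite family `s : ι → R`, then for every `F : MvPolynomial σ R` and every
`k`-linear functional `φ : R → k`,
`L_k(φ(F)) ≤ (5|ι|³ + 6|ι|² + 2|ι|) · L_R(F) + 3|ι|`.
[cite: HrubesYehudayoff2011, Thm 4.2 and its proof (§4)] -/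
theorem complexity_lmap_le_of_span (s : ι → R) (hs : Submodule.span k (Set.range s) = ⊤)
    (φ : R →ₗ[k] k) (F : MvPolynomial σ R) :
    complexity (CommExtSim.lmap φ F) ≤
      (5 * Fintype.card ι ^ 3 + 6 * Fintype.card ι ^ 2 + 2 * Fintype.card ι) * complexity F +
        3 * Fintype.card ι := by
  have hmem : ∀ r : R, r ∈ Submodule.span k (Set.range s) := fun r => by
    rw [hs]; exact Submodule.mem_top
  have hrep' : ∀ r : R, ∃ a : ι → k, ∑ c, a c • s c = r := fun r =>
    (Submodule.mem_span_range_iff_exists_fun (R := k)).1 (hmem r)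
  choose rep hrep using hrep'
  exact complexity_lmap_le_of_rep s rep hrep φ F

end Span

/-! ### Descent to the base ring -/

section Descent

variable [Algebra k R]

/-- A retraction kills the extension of scalars: if `φ(1) = 1` then `φ(F ⊗ 1) = F`. [folklore] -/
private theorem lmap_map_of_map_one (φ : R →ₗ[k] k) (hφ : φ 1 = 1) (F : MvPolynomial σ k) :
    CommExtSim.lmap φ (MvPolynomial.map (algebraMap k R) F) = F := by
  have h : MvPolynomial.map (algebraMap k R) F = C 1 * MvPolynomial.map (algebraMap k R) F := by
    rw [C_1, one_mul]
  rw [h, CommExtSim.lmap_C_mul_map, hφ, one_smul]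

/-- **Descent along a finitely generated extension with a retraction**: if `R` is spanned over
`k` by `s : ι → R` (`|ι| = d`) and `φ : R → k` is `k`-linear with `φ(1) = 1`, then every
`F ∈ k[X_σ]` satisfies `L_k(F) ≤ (5d³ + 6d² + 2d) · L_R(F) + 3d`: constants from `R` help at
most polynomially in `d` (the other direction `L_R(F) ≤ L_k(F)` is the tree's
`complexity_map_le`). This is the printed conclusion `C_R(f) ≤ O(k³) C_{R'}(f)` for `f ∈ R[X]`,
with the printed "`1 = e_1` in the basis" replaced by the retraction hypothesis (our
generalisation). [cite: HrubesYehudayoff2011, Thm 4.2] -/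
theorem complexity_le_of_span_of_retraction [Fintype ι] [Fintype σ] (s : ι → R)
    (hs : Submodule.span k (Set.range s) = ⊤) (φ : R →ₗ[k] k) (hφ : φ 1 = 1)
    (F : MvPolynomial σ k) :
    complexity F ≤
      (5 * Fintype.card ι ^ 3 + 6 * Fintype.card ι ^ 2 + 2 * Fintype.card ι) *
          complexity (MvPolynomial.map (algebraMap k R) F) + 3 * Fintype.card ι := by
  have h := complexity_lmap_le_of_span s hs φ (MvPolynomial.map (algebraMap k R) F)
  rwa [lmap_map_of_map_one φ hφ] at h

/-- **`ℤ/m → R` splits when `R` has characteristic `m`**: for a commutative `ℤ/m`-algebra `R`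
in which `m` is the characteristic (so `algebraMap : ℤ/m → R` is injective), there is a
`ℤ/m`-linear `φ : R → ℤ/m` with `φ(1) = 1`, because `ℤ/m` is an injective `ℤ/m`-module
(tree `Literature.GroupTheory.FiniteAbelian.zmod_injective`; Hungerford IV §6 Ex. 7 (d)).
[cite: Hungerford1974, Ch. IV §6 Exercise 7 (d)] -/
theorem exists_linearMap_zmod_map_one (m : ℕ) [NeZero m] (S : Type v) [CommRing S]
    [Algebra (ZMod m) S] [CharP S m] :
    ∃ φ : S →ₗ[ZMod m] ZMod m, φ 1 = 1 := by
  -- Baer for `ℤ/m` from the tree's injectivity statement (same universe), then extend the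
  -- identity of `ℤ/m` along the injective linear map `algebraMap : ℤ/m → S`.
  have hB : Module.Baer (ZMod m) (ZMod m) := fun I g => by
    obtain ⟨h, hh⟩ := (Literature.GroupTheory.FiniteAbelian.zmod_injective m).out
      I.subtype I.injective_subtype g
    exact ⟨h, fun x hx => hh ⟨x, hx⟩⟩
  let f : ZMod m →ₗ[ZMod m] S := (Algebra.ofId (ZMod m) S).toLinearMap
  have hf : Function.Injective f := by
    have hsub : (algebraMap (ZMod m) S) = ZMod.castHom (dvd_refl m) S := Subsingleton.elim _ _
    intro a b hab
    have hab' : algebraMap (ZMod m) S a = algebraMap (ZMod m) S b := hab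
    rw [hsub] at hab'
    exact ZMod.castHom_injective S hab'
  obtain ⟨φ, hφ⟩ := hB.extension_property f hf LinearMap.id
  refine ⟨φ, ?_⟩
  have h1 := LinearMap.congr_fun hφ 1
  simp only [f, LinearMap.comp_apply, LinearMap.id_apply, AlgHom.toLinearMap_apply, map_one] at h1
  exact h1

/-- **Descent to `ℤ/m`**: if the commutative ring `S` of characteristic `m` is spanned over
`ℤ/m` by `s : ι → S` (`|ι| = d`), then every `F ∈ (ℤ/m)[X_σ]` has
`L_{ℤ/m}(F) ≤ (5d³ + 6d² + 2d) · L_S(F) + 3d`. For `m = 2^(k+1)` and `S` a finite chain ring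
`GR(2^(k+1), f)[x]/(g, 2^k x^t)` (`d = e f` generators) this is the structure-constant descent
"residue degree and ramification polynomial in `n` do not help", uniformly in `k`.
[cite: HrubesYehudayoff2011, Thm 4.2] -/
theorem complexity_zmod_le_of_span [Fintype ι] [Fintype σ] (m : ℕ) [NeZero m] {S : Type v}
    [CommRing S]
    [Algebra (ZMod m) S] [CharP S m] (s : ι → S)
    (hs : Submodule.span (ZMod m) (Set.range s) = ⊤) (F : MvPolynomial σ (ZMod m)) :
    complexity F ≤
      (5 * Fintype.card ι ^ 3 + 6 * Fintype.card ι ^ 2 + 2 * Fintype.card ι) *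
          complexity (MvPolynomial.map (algebraMap (ZMod m) S) F) + 3 * Fintype.card ι := by
  obtain ⟨φ, hφ⟩ := exists_linearMap_zmod_map_one m S
  exact complexity_le_of_span_of_retraction s hs φ hφ F

/-- Over `ℤ/m` a family spans as soon as it generates additively. [folklore] -/
private theorem span_eq_top_of_addSubgroup_closure (m : ℕ) {S : Type v} [CommRing S]
    [Algebra (ZMod m) S] (s : ι → S) (hs : AddSubgroup.closure (Set.range s) = ⊤) :
    Submodule.span (ZMod m) (Set.range s) = ⊤ := by
  rw [eq_top_iff]
  intro x _
  have hx : x ∈ AddSubgroup.closure (Set.range s) := by rw [hs]; exact AddSubgroup.mem_top x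
  exact (AddSubgroup.closure_le (K := (Submodule.span (ZMod m) (Set.range s)).toAddSubgroup)).2
    (fun y hy => Submodule.subset_span hy) hx

/-- **Descent to `ℤ/m`, additive-generation form**: if `S` of characteristic `m` is generated
AS AN ADDITIVE GROUP by `s : ι → S` (`|ι| = d`), then
`L_{ℤ/m}(F) ≤ (5d³ + 6d² + 2d) · L_S(F) + 3d` for every `F ∈ (ℤ/m)[X_σ]`.
[cite: HrubesYehudayoff2011, Thm 4.2] -/
theorem complexity_zmod_le_of_addSubgroup_closure [Fintype ι] [Fintype σ] (m : ℕ) [NeZero m]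
    {S : Type v} [CommRing S]
    [Algebra (ZMod m) S] [CharP S m] (s : ι → S)
    (hs : AddSubgroup.closure (Set.range s) = ⊤) (F : MvPolynomial σ (ZMod m)) :
    complexity F ≤
      (5 * Fintype.card ι ^ 3 + 6 * Fintype.card ι ^ 2 + 2 * Fintype.card ι) *
          complexity (MvPolynomial.map (algebraMap (ZMod m) S) F) + 3 * Fintype.card ι :=
  complexity_zmod_le_of_span m s (span_eq_top_of_addSubgroup_closure m s hs) F

end Descent

end CommExtSimSpan

end Literature.Computability.AlgebraicComplexity
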